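import Summits.AnomalousDissipation.AnomalousDissipation.Theorems.SolenoidalFractalHomogenisationLagrangianStepWCrossing

/-!
# K1L_D (stmt-AnomalousDissipation-27980): the (W)-CROSSING line, part 2 — §4 window clause / family / the stub's ∃-statement, §5 the two
# obligations' receptacles at the branch-B point (`D1ExactFamily`, `ClosedFormWindowB`, `MB`, `ρB`, `ΦB`, `EvenSlackWindowB`) and the
# registry-v14 glue `cellLawV0_IS_of_W_D1`
(landed copy of `Cruxes/LagrangianRenormalisationStep/Lines/onelevel_W_crossing.lean` v2 §4–§5 minus the two named stubs and their two derived
decls; same namespace as part 1 so every declaration keeps its name; tenure D26-4, prover ad-k1loc-p3 g7 «TAKES-p3 #6»; split in two files only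
because of the 400-line cap; `--supports 27980 --as helper`.)
-/

set_option linter.dupNamespace false

namespace Summit.AnomalousDissipation.AnomalousDissipation.Theorems.SolenoidalFractalHomogenisation.LagrangianStep.WCrossing

open Summit.AnomalousDissipation.AnomalousDissipation.Theorems
open Summit.AnomalousDissipation.AnomalousDissipation.Theorems.SolenoidalFractalHomogenisation.LagrangianStep
open Literature.Analysis Literature.Analysis.FluidPDE Literature.Analysis.FunctionSpaces
open Set

noncomputable section

/-! ## §4 The window clause, the family with `μ ≡ 1`, and the stub's ∃-statement -/

/-- **The sectorial interval window clause for `Φ` from the design map's data + the residue.** [folklore] -/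
theorem windowClause_of_WCrossing {Φ Φ₀ : T4 → T4} {Sstar : T4} {slo shi lam₀ Λ τ₀ τlo τhi κ ε ρ δ : ℝ}
    (hstarI : Torus.NearIso Sstar slo shi) (hslo : 0 < slo) (hlam₀ : 1 ≤ lam₀) (hiso : InInterval Sstar lam₀ (Torus.isoVisc 1))
    (hO : SectorialOddChannelBoundOn Φ₀ Sstar lam₀ Λ κ ε τ₀) (hE : EvenSlackOnInterval Φ₀ Sstar lam₀ Λ τ₀ δ)
    (hR : ResidueOnInterval Φ Φ₀ Sstar lam₀ Λ τ₀ ρ)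
    (hκ : 0 ≤ κ) (hε : 0 ≤ ε) (hρ : 0 ≤ ρ) (hδ : 0 ≤ δ) (hfit : 1 ≤ (1 - ρ) * (1 + δ)) (hgain : κ + ρ < 1)
    (hτlo : (ε + 2 * ρ) / (1 - ρ - κ) ≤ τlo) (hτhi : τhi ≤ τ₀) :
    SectorialIntervalWindowClause Φ Sstar slo shi lam₀ Λ τlo τhi 1 := by
  have hstar : TransNonneg Sstar := transNonneg_of_nearIso hstarI hslo.le
  have hρ1 : ρ < 1 := by nlinarith
  have h1ρ : 0 < 1 - ρ := by linarith
  have hlam₀' : 0 < lam₀ := by linarith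
  have hκ' : 0 ≤ κ / (1 - ρ) := div_nonneg hκ h1ρ.le
  have hκ1' : κ / (1 - ρ) < 1 := by rw [div_lt_one h1ρ]; linarith
  have hε' : 0 ≤ (ε + 2 * ρ) / (1 - ρ) := div_nonneg (by linarith) h1ρ.le
  have hτlo' : (ε + 2 * ρ) / (1 - ρ) / (1 - κ / (1 - ρ)) ≤ τlo := by
    have : (ε + 2 * ρ) / (1 - ρ) / (1 - κ / (1 - ρ)) = (ε + 2 * ρ) / (1 - ρ - κ) := by
      have h2 : 1 - ρ - κ ≠ 0 := by linarith
      field_simp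
    rw [this]; exact hτlo
  exact sectorialIntervalWindowClause_of_channelBoundOn_of_gain_lt_one hstarI hslo.le hlam₀ hiso le_rfl hκ' hκ1' hε' hτlo' hτhi
    (oddChannelOn_of_residue hO hE hR hstar hlam₀' hδ hκ hε hρ hρ1)
    (evenHalf_of_residue hE hR hstar hlam₀' hδ hρ hfit (le_trans (div_nonneg (by linarith) (by linarith)) hτlo) hτhi)

/-- **The ν-family with `μ ≡ 1`.**  A design map `Φ₀` with the τ-local odd bound and the even clause with slack, a family `Φ ν` whose residue against `Φ₀`
is `ρ`-small UNIFORMLY IN `ν`, and the bookkeeping of the registered `SectorialIntervalWindowFamily` with the explicit choices `Λ' := Λ`, `lo := slo/Λc`,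
`hi := shi·Λc`, `τc := τlo`, `β := τlo·(shi·Λc)`, `τhi := τlo·ΛV·(shi·Λc)/(slo/Λc)`. [folklore] -/
theorem windowFamily_of_WCrossing {Φ : ℝ → T4 → T4} {Φ₀ : T4 → T4} {Sstar : T4} {slo shi lam₀ Λ Λc ΛV τ₀ τlo κ ε ρ δ : ℝ}
    (hstarI : Torus.NearIso Sstar slo shi) (hslo : 0 < slo) (hsh : slo ≤ shi) (hlam₀ : 1 ≤ lam₀) (hiso : InInterval Sstar lam₀ (Torus.isoVisc 1))
    (hO : SectorialOddChannelBoundOn Φ₀ Sstar lam₀ Λ κ ε τ₀) (hE : EvenSlackOnInterval Φ₀ Sstar lam₀ Λ τ₀ δ)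
    (hR : ∀ ν, ResidueOnInterval (Φ ν) Φ₀ Sstar lam₀ Λ τ₀ ρ)
    (hκ : 0 ≤ κ) (hε : 0 ≤ ε) (hρ : 0 ≤ ρ) (hδ : 0 ≤ δ) (hfit : 1 ≤ (1 - ρ) * (1 + δ)) (hgain : κ + ρ < 1)
    (hτlo : (ε + 2 * ρ) / (1 - ρ - κ) ≤ τlo)
    (hΛc : lam₀ ≤ Λc) (hΛV : 1 < ΛV) (hfitV : ΛV * Λc * shi ≤ Λ * slo)
    (hτ₀ : τlo * ΛV * (shi * Λc) / (slo / Λc) ≤ τ₀) :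
    SectorialIntervalWindowFamily Φ (fun _ => 1) Sstar slo shi lam₀ Λ Λc Λ τlo (τlo * ΛV * (shi * Λc) / (slo / Λc)) τlo
      (τlo * (shi * Λc)) (slo / Λc) (shi * Λc) ΛV := by
  have hρ1 : ρ < 1 := by nlinarith
  have hτlo0 : 0 ≤ τlo := le_trans (div_nonneg (by linarith) (by linarith)) hτlo
  have hΛc1 : 1 ≤ Λc := hlam₀.trans hΛc
  have hΛc0 : 0 < Λc := by linarith
  have hshi : 0 < shi := hslo.trans_le hsh
  have hlo0 : 0 < slo / Λc := div_pos hslo hΛc0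
  have hhi0 : 0 < shi * Λc := mul_pos hshi hΛc0
  -- Λc ≤ Λ from the V-fit: ΛV Λc shi Λc ≤ Λ slo with ΛV > 1, Λc ≥ 1, shi ≥ slo
  have hΛcΛ : Λc ≤ Λ := by
    have h1 : Λc * slo ≤ ΛV * Λc * shi := by
      have h2 : slo ≤ ΛV * shi := by nlinarith
      nlinarith
    nlinarith
  -- the τ window: τhi := τlo ΛV hi / lo ≥ τlo
  set τhi := τlo * ΛV * (shi * Λc) / (slo / Λc) with hτhi_def
  have hfac : 1 ≤ ΛV * (shi * Λc) / (slo / Λc) := by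
    rw [le_div_iff₀ hlo0]; nlinarith [div_le_self hslo.le hΛc1]
  have hτhi : τlo ≤ τhi := by
    have : τhi = τlo * (ΛV * (shi * Λc) / (slo / Λc)) := by rw [hτhi_def]; ring
    rw [this]; nlinarith
  have c1 : ∀ ν, SectorialIntervalWindowClause (Φ ν) Sstar slo shi lam₀ Λ τlo τhi 1 :=
    fun ν => windowClause_of_WCrossing hstarI hslo hlam₀ hiso hO hE (hR ν) hκ hε hρ hδ hfit hgain hτlo hτ₀
  have c7 : slo / Λc * Λc ≤ slo := by rw [div_mul_cancel₀ _ hΛc0.ne']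
  have c9 : Λ ∈ Set.Icc lam₀ Λ := ⟨hΛc.trans hΛcΛ, le_rfl⟩
  have c10 : ΛV * shi ≤ Λ * (slo / Λc) := by
    rw [mul_div_assoc', le_div_iff₀ hΛc0]
    have h3 : ΛV * Λc * shi = ΛV * shi * Λc := by ring
    linarith
  have c11 : ΛV * (shi * Λc) ≤ Λ * slo := by
    have h3 : ΛV * Λc * shi = ΛV * (shi * Λc) := by ring
    linarith
  have c12 : τlo ∈ Set.Icc τlo τhi := ⟨le_rfl, hτhi⟩
  have c15 : τlo * (shi * Λc) * ΛV / (slo / Λc) ∈ Set.Icc τlo τhi := by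
    have heq : τlo * (shi * Λc) * ΛV / (slo / Λc) = τhi := by rw [hτhi_def]; ring
    rw [heq]; exact ⟨hτhi, le_rfl⟩
  exact ⟨c1, fun _ => le_rfl, tailDefectBound_one hΛc, hslo, hΛc, hΛcΛ, c7, le_rfl, c9, c10, c11, c12, hτlo0, le_rfl, c15⟩

/-- Scaling: the residue currency is invariant under a common scalar factor. [folklore] -/
theorem RelSmall.smul {R A : T4} {ρ : ℝ} (h : RelSmall R A ρ) (a : ℝ) : RelSmall (a • R) (a • A) ρ := by
  intro k p q hp hq
  have := h k p q hp hq
  rw [Torus.bsymb_smul, Torus.symb_smul, Torus.symb_smul]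
  nlinarith [sq_nonneg a, this]

/-- **Packing into the registered stub's ∃-statement.**  The (W)-crossing data (§4) plus the (V) clause for the same family on the window
`(slo/Λc, shi·Λc, ΛV, β = τlo·shi·Λc)` give the conclusion of `stub_cellLawV0_IS` VERBATIM, with defect family `μ ≡ 1`. [folklore] -/
theorem cellLawV0_IS_statement_of_WCrossing {M : ℝ} (hM : 0 < M) {c : ℝ} (hc : 0 < c)
    {Φ : ℝ → T4 → T4} {Φ₀ : T4 → T4} {Sstar : T4} {slo shi lam₀ Λ Λc ΛV τ₀ τlo κ ε ρ δ : ℝ}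
    (hstarI : Torus.NearIso Sstar slo shi) (hslo : 0 < slo) (hslo1 : slo ≤ 1) (hshi1 : 1 ≤ shi) (hlam₀ : 1 ≤ lam₀)
    (hiso : InInterval Sstar lam₀ (Torus.isoVisc 1))
    (hO : SectorialOddChannelBoundOn Φ₀ Sstar lam₀ Λ κ ε τ₀) (hE : EvenSlackOnInterval Φ₀ Sstar lam₀ Λ τ₀ δ)
    (hR : ∀ ν, ResidueOnInterval (Φ ν) Φ₀ Sstar lam₀ Λ τ₀ ρ)
    (hκ : 0 ≤ κ) (hε : 0 ≤ ε) (hρ : 0 ≤ ρ) (hδ : 0 ≤ δ) (hfit : 1 ≤ (1 - ρ) * (1 + δ)) (hgain : κ + ρ < 1)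
    (hτlo : (ε + 2 * ρ) / (1 - ρ - κ) ≤ τlo)
    (hΛc : lam₀ ≤ Λc) (hΛV : 1 < ΛV) (hfitV : ΛV * Λc * shi ≤ Λ * slo)
    (hτ₀ : τlo * ΛV * (shi * Λc) / (slo / Λc) ≤ τ₀)
    (hV : ∃ σ > (0:ℝ), ∃ C : ℝ, 0 ≤ C ∧ ∃ ν₀ > (0:ℝ), ∃ K > (0:ℝ),
      SlowVectorClauseNoExF cubatureWord M hM c Φ (slo / Λc) (shi * Λc) ΛV (τlo * (shi * Λc)) σ C ν₀ K) :
    ∃ M : ℝ, ∃ hM : 0 < M, ∃ c > (0:ℝ), ∃ Φ : ℝ → Torus.Visc4 (Fin 3) → Torus.Visc4 (Fin 3), ∃ μ : ℝ → ℝ, ∃ Sstar : Torus.Visc4 (Fin 3),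
      ∃ slo shi lam₀ Λ Λc Λ' τlo τhi τc : ℝ, ∃ lo > (0:ℝ), ∃ hi : ℝ, lo ≤ 1 ∧ 1 ≤ hi ∧ ∃ ΛV > (1:ℝ), ∃ β ≥ (0:ℝ),
        SectorialIntervalWindowFamily Φ μ Sstar slo shi lam₀ Λ Λc Λ' τlo τhi τc β lo hi ΛV ∧
        ∃ σ > (0:ℝ), ∃ C : ℝ, 0 ≤ C ∧ ∃ ν₀ > (0:ℝ), ∃ K > (0:ℝ), SlowVectorClauseNoExF cubatureWord M hM c Φ lo hi ΛV β σ C ν₀ K := by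
  have hsh : slo ≤ shi := hslo1.trans hshi1
  have hΛc1 : 1 ≤ Λc := hlam₀.trans hΛc
  have hΛc0 : 0 < Λc := by linarith
  have hρ1 : ρ < 1 := by nlinarith
  have hτlo0 : 0 ≤ τlo := le_trans (div_nonneg (by linarith) (by linarith)) hτlo
  have hlo1 : slo / Λc ≤ 1 := (div_le_self hslo.le hΛc1).trans hslo1
  have hhi1 : 1 ≤ shi * Λc := one_le_mul_of_one_le_of_one_le hshi1 hΛc1
  have hβ : 0 ≤ τlo * (shi * Λc) := mul_nonneg hτlo0 (by positivity)
  exact ⟨M, hM, c, hc, Φ, fun _ => 1, Sstar, slo, shi, lam₀, Λ, Λc, Λ, τlo, τlo * ΛV * (shi * Λc) / (slo / Λc), τlo, slo / Λc,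
    div_pos hslo hΛc0, shi * Λc, hlo1, hhi1, ΛV, hΛV, τlo * (shi * Λc), hβ,
    windowFamily_of_WCrossing hstarI hslo hsh hlam₀ hiso hO hE hR hκ hε hρ hδ hfit hgain hτlo hΛc hΛV hfitV hτ₀, hV⟩

/-! ## §5 The two remaining obligations at the branch-B point, and the stub from them

Both obligations are parametrised by the DESIGN MAP `Φ₀` (normalisation included) and the RESIDUE BUDGET `ρ`; the named stubs instantiate them at
`Φ₀ := ΦB a = a • excQS cubatureWord MB` (`MB := 1/50`, `T₀ = 160π²·MB = 31.6 ≥ 30`: the landed odd design point `oddSectorial_excQS_design_point'` applies BY NAME) and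
`ρ := ρB := 1.2·10⁻⁴` — variant A: the ν-free adjacent-pair memory term (`pairQS`, measured 5.4·10⁻⁵–9.7·10⁻⁵ relative on the block window, CONFIRMED by the
dynamics j319254) is BUDGETED AS RESIDUE; variant B (memo §4): type `pairQS`, take `Φ₀ := a • (excQS + pairQS)` and `ρ := 10⁻⁵` (true residue ≤ 3·10⁻¹⁰). -/

/-- **OBLIGATION D1 (exact family; (V) = w1 g4 S1a/V0, residue = D1).**  There is a family `Ψ ν` of effective maps (intended: the normalised exact
ξ²-coefficient / periodic-corrector Green–Kubo map of the cell problem at parameter `M`, cf. `…CellLawVSlowGraphHomogenised` G8) which (i) is `ρ`-close to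
the design map `Φ₀` in `RelSmall` currency on the block window `NearIso(10/11, 11/10)`, sectors `τ ≤ 1/20`, UNIFORMLY IN `ν`, and (ii) satisfies the (V)
linear-response clause with one amplitude `c > 0` on every sub-window of the block window. -/
def D1ExactFamily (Φ₀ : T4 → T4) (ρ M : ℝ) (hM : 0 < M) : Prop :=
  ∃ Ψ : ℝ → T4 → T4,
    (∀ ν : ℝ, ∀ S : T4, Torus.NearIso S (10 / 11) (11 / 10) → ∀ τ ∈ Set.Icc (0:ℝ) (1 / 20), OddSectorial S τ →
        RelSmall (Ψ ν S - Φ₀ S) (Φ₀ S) ρ) ∧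
    (∃ c > (0:ℝ), ∀ lo hi ΛV β : ℝ, 0 < lo → lo ≤ hi → 1 < ΛV → 0 ≤ β → hi * ΛV ≤ 11 / 10 → 10 / 11 * ΛV ≤ lo →
        ∃ σ > (0:ℝ), ∃ C : ℝ, 0 ≤ C ∧ ∃ ν₀ > (0:ℝ), ∃ K > (0:ℝ), SlowVectorClauseNoExF cubatureWord M hM c Ψ lo hi ΛV β σ C ν₀ K)

/-- **OBLIGATION W₀ (closed-form window with slack; owner: the K1L_D even-half design lane — NOT D1).**  An (eigen-)centre `S⋆` and window data such that the
design map `Φ₀` satisfies the τ-local ODD channel bound (gain `κ`, source `ε`; for `a·excQS`: the landed design point κ = 93/100, ε = 0 after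
`InInterval → NearIso(10/11, 11/10)`, scale-free by `oddSectorial_smul_iff`) and the EVEN clause WITH SLACK `δ ≥ ρ/(1−ρ)` on `λ ∈ [λ₀, Λ]`, `τ ≤ τ₀`, plus the
bookkeeping fits of the registered family (`Λ ≥ ΛV·Λc·shi/slo`, window inside the block window, τ-window below `τ₀ ≤ 1/20`).  PROFILE (j319221/j319319, eigen-
centred, `Φ₀ = a⋆·excQS`, T₀ = 30): slack ≈ 5.5·10⁻³(λ−1) − 0.092·τ² on the extreme families; I-centred NEGATIVE for λ < 1.10. -/
def ClosedFormWindowB (Φ₀ : T4 → T4) (ρ : ℝ) : Prop :=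
  ∃ Sstar : T4, ∃ slo shi lam₀ Λ Λc ΛV τ₀ κ ε δ : ℝ,
    Torus.NearIso Sstar slo shi ∧ 0 < slo ∧ slo ≤ 1 ∧ 1 ≤ shi ∧ 1 ≤ lam₀ ∧ InInterval Sstar lam₀ (Torus.isoVisc 1) ∧
    0 ≤ κ ∧ 0 ≤ ε ∧ 0 ≤ δ ∧ 1 ≤ (1 - ρ) * (1 + δ) ∧ κ + ρ < 1 ∧ lam₀ ≤ Λc ∧ 1 < ΛV ∧ ΛV * Λc * shi ≤ Λ * slo ∧
    shi * Λ ≤ 11 / 10 ∧ 10 / 11 * Λ ≤ slo ∧ shi * Λc * ΛV ≤ 11 / 10 ∧ 10 / 11 * ΛV ≤ slo / Λc ∧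
    (ε + 2 * ρ) / (1 - ρ - κ) * ΛV * (shi * Λc) / (slo / Λc) ≤ τ₀ ∧ τ₀ ≤ 1 / 20 ∧
    SectorialOddChannelBoundOn Φ₀ Sstar lam₀ Λ κ ε τ₀ ∧
    EvenSlackOnInterval Φ₀ Sstar lam₀ Λ τ₀ δ

/-- **The conclusion of `stub_cellLawV0_IS` from the two obligations** (any design map `Φ₀`, budget `ρ ≥ 0`, parameter `M > 0`). [folklore] -/
theorem cellLawV0_IS_statement_of_D1 {Φ₀ : T4 → T4} {ρ M : ℝ} (hM : 0 < M) (hρ0 : 0 ≤ ρ)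
    (hW : ClosedFormWindowB Φ₀ ρ) (hD : D1ExactFamily Φ₀ ρ M hM) :
    ∃ M : ℝ, ∃ hM : 0 < M, ∃ c > (0:ℝ), ∃ Φ : ℝ → Torus.Visc4 (Fin 3) → Torus.Visc4 (Fin 3), ∃ μ : ℝ → ℝ, ∃ Sstar : Torus.Visc4 (Fin 3),
      ∃ slo shi lam₀ Λ Λc Λ' τlo τhi τc : ℝ, ∃ lo > (0:ℝ), ∃ hi : ℝ, lo ≤ 1 ∧ 1 ≤ hi ∧ ∃ ΛV > (1:ℝ), ∃ β ≥ (0:ℝ),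
        SectorialIntervalWindowFamily Φ μ Sstar slo shi lam₀ Λ Λc Λ' τlo τhi τc β lo hi ΛV ∧
        ∃ σ > (0:ℝ), ∃ C : ℝ, 0 ≤ C ∧ ∃ ν₀ > (0:ℝ), ∃ K > (0:ℝ), SlowVectorClauseNoExF cubatureWord M hM c Φ lo hi ΛV β σ C ν₀ K := by
  obtain ⟨Sstar, slo, shi, lam₀, Λ, Λc, ΛV, τ₀, κ, ε, δ, hstarI, hslo, hslo1, hshi1, hlam₀, hiso, hκ, hε, hδ, hfit, hgain, hΛc, hΛV,
    hfitV, hwinhi, hwinlo, hVhi, hVlo, hτ₀, hτ₀', hO, hE⟩ := hW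
  obtain ⟨Ψ, hres, c, hc, hVc⟩ := hD
  have hΛc1 : 1 ≤ Λc := hlam₀.trans hΛc
  have hΛc0 : 0 < Λc := by linarith
  set τlo : ℝ := (ε + 2 * ρ) / (1 - ρ - κ) with hτlo_def
  have hτlo0 : 0 ≤ τlo := div_nonneg (by linarith) (by linarith)
  -- the residue on the interval window
  have hR : ∀ ν, ResidueOnInterval (Ψ ν) Φ₀ Sstar lam₀ Λ τ₀ ρ := by
    intro ν lam hlam S τ hτ hSi hSo
    have hlam1 : 1 ≤ lam := hlam₀.trans hlam.1
    have hlam0 : 0 < lam := by linarith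
    have hN : Torus.NearIso S (10 / 11) (11 / 10) := by
      refine (InInterval.nearIso hlam1 hstarI hSi).mono ?_ ?_
      · rw [le_div_iff₀ hlam0]; nlinarith [hlam.2]
      · nlinarith [hlam.2, hslo.trans_le (hslo1.trans hshi1)]
    exact hres ν S hN τ ⟨hτ.1, hτ.2.trans hτ₀'⟩ hSo
  -- the (V) clause on the window (slo/Λc, shi·Λc, ΛV, τlo·shi·Λc)
  have hV := hVc (slo / Λc) (shi * Λc) ΛV (τlo * (shi * Λc)) (div_pos hslo hΛc0)
    ((div_le_self hslo.le hΛc1).trans (hslo1.trans (hshi1.trans (le_mul_of_one_le_right (by linarith) hΛc1))))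
    hΛV (mul_nonneg hτlo0 (by positivity)) hVhi hVlo
  exact cellLawV0_IS_statement_of_WCrossing hM hc hstarI hslo hslo1 hshi1 hlam₀ hiso hO hE hR hκ hε hρ0 hδ hfit hgain le_rfl hΛc hΛV hfitV hτ₀ hV

/-- Branch-B relaxation parameter `M_B = 1/50` (`T_min = 160π²/50 = 31.6 ≥ 30`, the hypothesis of the landed `oddSectorial_excQS_design_point'`). -/
def MB : ℝ := 1 / 50

/-- `0 < M_B`. -/
theorem MB_pos : 0 < MB := by norm_num [MB]

/-- The residue budget of D1 in `RelSmall` currency, variant A (pair memory budgeted as residue): `1.2·10⁻⁴`. -/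
def ρB : ℝ := 3 / 25000

/-- `0 ≤ ρ_B`. -/
theorem ρB_nonneg : 0 ≤ ρB := by norm_num [ρB]

/-- The normalised quasi-static design map at branch B. -/
def ΦB (a : ℝ) : T4 → T4 := fun S => a • excQS cubatureWord MB S

/-- **The ODD conjunct of `ClosedFormWindowB (ΦB a) ρ` is DISCHARGED by the landed design point** (`oddSectorial_excQS_design_point'`, κ = 93/100, ε = 0,
τ ≤ 1/5) for ANY normalisation `a` (`OddSectorial.smul`) on any interval window contained in the block window (`shi·Λ ≤ 11/10`, `10/11·Λ ≤ slo`). [folklore] -/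
theorem oddChannelOn_ΦB (a : ℝ) {Sstar : T4} {slo shi lam₀ Λ τ₀ : ℝ} (hstarI : Torus.NearIso Sstar slo shi) (hslo : 0 < slo) (hsh : slo ≤ shi)
    (hlam₀ : 1 ≤ lam₀) (hwinhi : shi * Λ ≤ 11 / 10) (hwinlo : 10 / 11 * Λ ≤ slo) (hτ₀ : τ₀ ≤ 1 / 5) :
    SectorialOddChannelBoundOn (ΦB a) Sstar lam₀ Λ (93 / 100) 0 τ₀ := by
  intro lam hlam S τ hτ hSi hSo
  have hlam1 : 1 ≤ lam := hlam₀.trans hlam.1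
  have hlam0 : 0 < lam := by linarith
  have hN : Torus.NearIso S (10 / 11) (11 / 10) := by
    refine (InInterval.nearIso hlam1 hstarI hSi).mono ?_ ?_
    · rw [le_div_iff₀ hlam0]; nlinarith [hlam.2]
    · nlinarith [hlam.2, hslo.trans_le hsh]
  have h := (OddGain.oddSectorial_excQS_design_point' (Mlag := MB) (le_of_eq rfl) ⟨hτ.1, hτ.2.trans hτ₀⟩ hN hSo).smul a
  simpa only [ΦB, add_zero] using h

/-- **The EVEN-ONLY form of obligation W₀** at branch B: numeric side conditions + the even clause with slack about an (eigen-)centre; the odd conjunct is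
supplied by `oddChannelOn_ΦB` (κ = 93/100, ε = 0). -/
def EvenSlackWindowB (a : ℝ) (ρ : ℝ) : Prop :=
  ∃ Sstar : T4, ∃ slo shi lam₀ Λ Λc ΛV τ₀ δ : ℝ,
    Torus.NearIso Sstar slo shi ∧ 0 < slo ∧ slo ≤ 1 ∧ 1 ≤ shi ∧ 1 ≤ lam₀ ∧ InInterval Sstar lam₀ (Torus.isoVisc 1) ∧
    0 ≤ δ ∧ 1 ≤ (1 - ρ) * (1 + δ) ∧ 93 / 100 + ρ < 1 ∧ lam₀ ≤ Λc ∧ 1 < ΛV ∧ ΛV * Λc * shi ≤ Λ * slo ∧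
    shi * Λ ≤ 11 / 10 ∧ 10 / 11 * Λ ≤ slo ∧ shi * Λc * ΛV ≤ 11 / 10 ∧ 10 / 11 * ΛV ≤ slo / Λc ∧
    (0 + 2 * ρ) / (1 - ρ - 93 / 100) * ΛV * (shi * Λc) / (slo / Λc) ≤ τ₀ ∧ τ₀ ≤ 1 / 20 ∧
    EvenSlackOnInterval (ΦB a) Sstar lam₀ Λ τ₀ δ

/-- `EvenSlackWindowB a ρ → ClosedFormWindowB (ΦB a) ρ` (odd conjunct by the design point). [folklore] -/
theorem closedFormWindowB_of_evenSlack {a ρ : ℝ} (h : EvenSlackWindowB a ρ) : ClosedFormWindowB (ΦB a) ρ := by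
  obtain ⟨Sstar, slo, shi, lam₀, Λ, Λc, ΛV, τ₀, δ, hstarI, hslo, hslo1, hshi1, hlam₀, hiso, hδ, hfit, hgain, hΛc, hΛV, hfitV,
    hwinhi, hwinlo, hVhi, hVlo, hτ₀, hτ₀', hE⟩ := h
  exact ⟨Sstar, slo, shi, lam₀, Λ, Λc, ΛV, τ₀, 93 / 100, 0, δ, hstarI, hslo, hslo1, hshi1, hlam₀, hiso, by norm_num, le_rfl, hδ, hfit, hgain, hΛc, hΛV,
    hfitV, hwinhi, hwinlo, hVhi, hVlo, hτ₀, hτ₀',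
    oddChannelOn_ΦB a hstarI hslo (hslo1.trans hshi1) hlam₀ hwinhi hwinlo (hτ₀'.trans (by norm_num)), hE⟩

/-- **Registry-v14 glue: `stub_cellLawV0_IS` from the two by-name obligations** — the even-slack window at the branch-B point for some
normalisation `a` (`∃ a > 0, EvenSlackWindowB a ρB`) and the exact family against the normalised design map for every normalisation
(`∀ a > 0, D1ExactFamily (ΦB a) ρB MB MB_pos`) give the registered stub's statement VERBATIM (its `ScalarLawBlock` hypothesis is unused on
this line: the isotropic scalar law is replaced by the eigen-centred tensor window). -/
theorem cellLawV0_IS_of_W_D1 (hW : ∃ a > (0:ℝ), EvenSlackWindowB a ρB)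
    (hD : ∀ a > (0:ℝ), D1ExactFamily (ΦB a) ρB MB MB_pos) :
    ScalarLawBlock Summit.AnomalousDissipation.AnomalousDissipation.Theorems.cubatureWord Summit.AnomalousDissipation.AnomalousDissipation.Theorems.c0 →
    ∃ M : ℝ, ∃ hM : 0 < M, ∃ c > (0:ℝ), ∃ Φ : ℝ → Torus.Visc4 (Fin 3) → Torus.Visc4 (Fin 3), ∃ μ : ℝ → ℝ,
      ∃ Sstar : Torus.Visc4 (Fin 3), ∃ slo shi lam₀ Λ Λc Λ' τlo τhi τc : ℝ,
      ∃ lo > (0:ℝ), ∃ hi : ℝ, lo ≤ 1 ∧ 1 ≤ hi ∧ ∃ ΛV > (1:ℝ), ∃ β ≥ (0:ℝ),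
      SectorialIntervalWindowFamily Φ μ Sstar slo shi lam₀ Λ Λc Λ' τlo τhi τc β lo hi ΛV ∧
      ∃ σ > (0:ℝ), ∃ C : ℝ, 0 ≤ C ∧ ∃ ν₀ > (0:ℝ), ∃ K > (0:ℝ), SlowVectorClauseNoExF Summit.AnomalousDissipation.AnomalousDissipation.Theorems.cubatureWord M hM c Φ lo hi ΛV β σ C ν₀ K := by
  intro _
  obtain ⟨a, ha, h⟩ := hW
  exact cellLawV0_IS_statement_of_D1 MB_pos ρB_nonneg (closedFormWindowB_of_evenSlack h) (hD a ha)

end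

end Summit.AnomalousDissipation.AnomalousDissipation.Theorems.SolenoidalFractalHomogenisation.LagrangianStep.WCrossing
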